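import Literature.Topology.FourManifolds.SurfaceGroupHandleMoves
import Literature.Topology.FourManifolds.SurfaceGroupTransvection
import Mathlib.Tactic.Group
import HarnessLib

/-!
# The explicit handle moves of the surface group lift to the free group (Nielsen lifts)

Topic `Literature/Topology/FourManifolds`; theorems over `SurfaceGroupHandleMoves.lean`,
`SurfaceGroupTransvection.lean` (the explicit automorphisms `flipEquiv`, `cutSwapEquiv`,
`slideEquiv`, `coslideEquiv`, `transvEquiv`, `transvAEquiv` of
`S_g = ⟨a₀, b₀, …, a_{g-1}, b_{g-1} ∣ ∏ᵢ [aᵢ, bᵢ]⟩`, each given by generator images fixing the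
surface relator on the nose IN `S_g`).

An automorphism `α` of `S_g` is *liftable* (the hypothesis shape of
`TrisectionKernels.iso_stabilize_map_of_lift`, `liftable_refl/conj/trans/symm` in
`TrisectionFunctorGKStabilization.lean`, and of the named fact
`nielsen_surfaceGroup_mulEquiv_lift` — Nielsen 1927: EVERY automorphism is liftable) when it is
induced by an automorphism `φ` of the free group `F⟨a₀, …, b_{g-1}⟩` sending the relator `r_g` to
a conjugate of `r_g^{±1}`:
`∃ φ c ε, (ε = 1 ∨ ε = -1) ∧ φ r_g = c · r_g^ε · c⁻¹ ∧ ∀ x, [φ x] = α [x]`.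
This file proves the EASY, explicit instances of Nielsen's theorem needed to reduce it to
generators (Zieschang–Vogt–Coldewey, §5.1: "we shall attain an `α̂` to a given `α`"; the moves are
the algebraic shadows of homeomorphisms of `Σ_g` fixing a disc, whose action on
`π₁(Σ_g ∖ disc) = F_{2g}` is the lift):

* `SurfaceGroup.liftable_of_gens` — the constructor: generator images `f` in the FREE group with
  inverse images `f'` (mutually inverse on generators in `F`) and
  `f̂(r_g) = c · r_g^ε · c⁻¹` induce a liftable automorphism; `lift_surfaceRelator_eq_self_of_forall`
  (handle-local images with `[f aᵢ, f bᵢ] = [aᵢ, bᵢ]` in `F` fix `r_g` on the nose) and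
  `lift_surfaceRelator_eq_self_of_block` (two-handle images fixing the block
  `[a_k,b_k] · ∏_{k<h<l}[a_h,b_h] · [a_l,b_l]` in `F`);
* `liftable_flipEquiv`, `liftable_cutSwapEquiv`, `liftable_transvEquiv`, `liftable_transvAEquiv` —
  the inversion move, the cut swaps and the two handle transvections (Dehn twists about `a_k`,
  `b_k`) lift, with `ε = 1` and `c = 1`: the SAME words, read in the free group, define an
  automorphism of `F` fixing `r_g` on the nose, because every identity used to build the move in
  `S_g` is an identity of the free group (discharged by `group`).

The handle slides `slideEquiv`, `coslideEquiv` are treated in `SurfaceGroupLiftableSlides.lean`;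
the reduction of Nielsen's theorem to the twist group of a handlebody in
`SurfaceGroupNielsenReduction.lean`.  Not here: Nielsen's theorem itself (named fact
`nielsen_surfaceGroup_mulEquiv_lift`, `TrisectionFunctorGKStabilizationSplit.lean`).

## References

* J. Nielsen, *Untersuchungen zur Topologie der geschlossenen zweiseitigen Flächen*, Acta Math. 50
  (1927) 189–358, §§ 1–2. [Nielsen1927]
* H. Zieschang, E. Vogt, H.-D. Coldewey, *Surfaces and Planar Discontinuous Groups*, LNM 835
  (1980), §5.1 and Thm. 5.6.1. [ZieschangVogtColdewey1980]
* R. C. Lyndon, P. E. Schupp, *Combinatorial Group Theory* (2001), Ch. I §4 (last remark).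
  [LyndonSchupp2001]
-/

noncomputable section

namespace Literature.Topology.FourManifolds

namespace SurfaceGroup

open HandleWords

variable {g : ℕ}

/-! ## Free lifts of the generators -/

/-- `[aᵢ]` is `aᵢ`: the class of the free generator `genA i` in `S_g` is `a i`. [folklore] -/
@[simp] theorem mk_genA (i : Fin g) :
    PresentedGroup.mk ({surfaceRelator g} : Set (FreeGroup (surfaceGen g))) (genA i) = a i := rfl

/-- `[bᵢ]` is `bᵢ`: the class of the free generator `genB i` in `S_g` is `b i`. [folklore] -/
@[simp] theorem mk_genB (i : Fin g) :
    PresentedGroup.mk ({surfaceRelator g} : Set (FreeGroup (surfaceGen g))) (genB i) = b i := rfl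

/-- The class of a free generator is the corresponding generator of `S_g`. [folklore] -/
theorem mk_freeGroup_of (p : surfaceGen g) :
    PresentedGroup.mk ({surfaceRelator g} : Set (FreeGroup (surfaceGen g))) (FreeGroup.of p) =
      PresentedGroup.of p := rfl

/-! ## The constructor: liftable automorphisms from free generator images -/

/-- **Liftability from free generator images.**  Let `α` be an automorphism of `S_g` whose
generator images are the classes of words `f p` of the free group, and suppose the `f p` have
inverse images `f' p` in the free group (`f̂' (f p) = p`, `f̂ (f' p) = p`) and
`f̂(r_g) = c · r_g^ε · c⁻¹` with `ε = ±1`.  Then `α` is liftable: `f̂` is an automorphism of the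
free group inducing `α`.  (The shape of the conclusion is the hypothesis of
`TrisectionKernels.iso_stabilize_map_of_lift` and of the named fact
`nielsen_surfaceGroup_mulEquiv_lift`.) [cite: ZieschangVogtColdewey1980, §5.1 and Thm. 5.6.1] -/
theorem liftable_of_gens (α : SurfaceGroup g ≃* SurfaceGroup g)
    (f f' : surfaceGen g → FreeGroup (surfaceGen g)) (c : FreeGroup (surfaceGen g)) (ε : ℤ)
    (hε : ε = 1 ∨ ε = -1)
    (hf : FreeGroup.lift f (surfaceRelator g) = c * surfaceRelator g ^ ε * c⁻¹)
    (h₁ : ∀ p, FreeGroup.lift f' (f p) = FreeGroup.of p)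
    (h₂ : ∀ p, FreeGroup.lift f (f' p) = FreeGroup.of p)
    (hα : ∀ p, α (PresentedGroup.of p) = PresentedGroup.mk _ (f p)) :
    ∃ (φ : FreeGroup (surfaceGen g) ≃* FreeGroup (surfaceGen g)) (c : FreeGroup (surfaceGen g))
      (ε : ℤ), (ε = 1 ∨ ε = -1) ∧ φ (surfaceRelator g) = c * surfaceRelator g ^ ε * c⁻¹ ∧
      ∀ x, PresentedGroup.mk _ (φ x) = α (PresentedGroup.mk _ x) := by
  refine ⟨MonoidHom.toMulEquiv (FreeGroup.lift f) (FreeGroup.lift f')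
      (FreeGroup.ext_hom _ _ fun p => by simp [h₁ p])
      (FreeGroup.ext_hom _ _ fun p => by simp [h₂ p]), c, ε, hε, hf, fun x => ?_⟩
  have H : (PresentedGroup.mk ({surfaceRelator g} : Set (FreeGroup (surfaceGen g)))).comp
      (FreeGroup.lift f) =
      α.toMonoidHom.comp (PresentedGroup.mk ({surfaceRelator g} : Set (FreeGroup (surfaceGen g)))) :=
    FreeGroup.ext_hom _ _ fun p => by
      rw [MonoidHom.comp_apply, MonoidHom.comp_apply, FreeGroup.lift_apply_of,
        MulEquiv.coe_toMonoidHom, mk_freeGroup_of, hα p]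
  exact DFunLike.congr_fun H x

/-- **Handle-local free images preserving each `[aᵢ, bᵢ]` fix the relator on the nose**: if
`f(aᵢ) f(bᵢ) f(aᵢ)⁻¹ f(bᵢ)⁻¹ = aᵢ bᵢ aᵢ⁻¹ bᵢ⁻¹` in the free group for every `i`, then
`f̂(r_g) = r_g`. [folklore] -/
theorem lift_surfaceRelator_eq_self_of_forall (f : surfaceGen g → FreeGroup (surfaceGen g))
    (h : ∀ i : Fin g, f (i, false) * f (i, true) * (f (i, false))⁻¹ * (f (i, true))⁻¹ =
      genA i * genB i * (genA i)⁻¹ * (genB i)⁻¹) :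
    FreeGroup.lift f (surfaceRelator g) = surfaceRelator g := by
  have hfun : relFactor f = relFactor (FreeGroup.of : surfaceGen g → FreeGroup (surfaceGen g)) := by
    funext i
    by_cases hi : i < g
    · rw [relFactor_fin f ⟨i, hi⟩, relFactor_fin FreeGroup.of ⟨i, hi⟩]
      exact h ⟨i, hi⟩
    · simp [relFactor, hi]
  conv_rhs => rw [← FreeGroup.lift_of_apply (surfaceRelator g)]
  rw [lift_surfaceRelator, lift_surfaceRelator, hfun]

/-- The class of the free middle block `∏_{k<h<l} [a_h, b_h]` is `mid k l`. [folklore] -/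
theorem mk_prod_map_relFactor_of (k l : ℕ) :
    PresentedGroup.mk ({surfaceRelator g} : Set (FreeGroup (surfaceGen g)))
      (((List.range' (k + 1) (l - k - 1)).map
        (relFactor (FreeGroup.of : surfaceGen g → FreeGroup (surfaceGen g)))).prod) = mid k l := by
  unfold mid
  rw [map_list_prod, List.map_map]
  congr 1
  refine List.map_congr_left fun i _ => ?_
  rw [Function.comp_apply, map_relFactor]
  rfl

/-- **Two-handle free images fixing the block fix the relator on the nose**: if `f` is the
identity off the handles `k < l` and
`[f a_k, f b_k] · m · [f a_l, f b_l] = [a_k, b_k] · m · [a_l, b_l]` in the free group, where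
`m = ∏_{k<h<l} [a_h, b_h]` is the free middle block, then `f̂(r_g) = r_g`. [folklore] -/
theorem lift_surfaceRelator_eq_self_of_block {k l : Fin g} (hkl : k < l)
    (f : surfaceGen g → FreeGroup (surfaceGen g))
    (hoff : ∀ i : Fin g, i ≠ k → i ≠ l → ∀ s, f (i, s) = FreeGroup.of (i, s))
    (hblock : f (k, false) * f (k, true) * (f (k, false))⁻¹ * (f (k, true))⁻¹ *
      (((List.range' (k + 1) (l - k - 1)).map
        (relFactor (FreeGroup.of : surfaceGen g → FreeGroup (surfaceGen g)))).prod *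
        (f (l, false) * f (l, true) * (f (l, false))⁻¹ * (f (l, true))⁻¹)) =
      genA k * genB k * (genA k)⁻¹ * (genB k)⁻¹ *
      (((List.range' (k + 1) (l - k - 1)).map
        (relFactor (FreeGroup.of : surfaceGen g → FreeGroup (surfaceGen g)))).prod *
        (genA l * genB l * (genA l)⁻¹ * (genB l)⁻¹))) :
    FreeGroup.lift f (surfaceRelator g) = surfaceRelator g := by
  conv_rhs => rw [← FreeGroup.lift_of_apply (surfaceRelator g)]
  rw [lift_surfaceRelator, lift_surfaceRelator]
  refine prod_map_range_eq_of_block (F' := relFactor f)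
    (F := relFactor (FreeGroup.of : surfaceGen g → FreeGroup (surfaceGen g))) hkl l.2 ?_ ?_
  · intro i hik hil
    unfold relFactor
    split_ifs with hi
    · have hik' : (⟨i, hi⟩ : Fin g) ≠ k := fun e => hik (congrArg Fin.val e)
      have hil' : (⟨i, hi⟩ : Fin g) ≠ l := fun e => hil (congrArg Fin.val e)
      simp [hoff ⟨i, hi⟩ hik' hil']
    · rfl
  · simpa [relFactor_fin, genA, genB] using hblock

/-! ## The inversion move lifts -/

/-- **The inversion move `flipEquiv k` is liftable** (`ε = 1`, `c = 1`): the words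
`a_k ↦ b_k a_k⁻¹ b_k⁻¹`, `b_k ↦ b_k a_k b_k⁻²` (inverse `a_k ↦ [a_k,b_k] a_k⁻¹`, `b_k ↦ b_k⁻¹ a_k⁻¹`)
define an automorphism of the free group fixing `r_g` on the nose — the action on
`π₁(Σ_g ∖ disc)` of the half-twist of the `k`-th handle. [cite: ZieschangVogtColdewey1980, §5.1 and Thm. 5.6.1] -/
theorem liftable_flipEquiv (k : Fin g) :
    ∃ (φ : FreeGroup (surfaceGen g) ≃* FreeGroup (surfaceGen g)) (c : FreeGroup (surfaceGen g))
      (ε : ℤ), (ε = 1 ∨ ε = -1) ∧ φ (surfaceRelator g) = c * surfaceRelator g ^ ε * c⁻¹ ∧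
      ∀ x, PresentedGroup.mk _ (φ x) = flipEquiv k (PresentedGroup.mk _ x) := by
  refine liftable_of_gens (flipEquiv k)
    (fun p => if p.1 = k then
        (bif p.2 then genB k * genA k * (genB k)⁻¹ * (genB k)⁻¹ else genB k * (genA k)⁻¹ * (genB k)⁻¹)
      else FreeGroup.of p)
    (fun p => if p.1 = k then
        (bif p.2 then (genB k)⁻¹ * (genA k)⁻¹ else genA k * genB k * (genA k)⁻¹ * (genB k)⁻¹ * (genA k)⁻¹)
      else FreeGroup.of p)
    1 1 (Or.inl rfl) ?_ ?_ ?_ ?_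
  · rw [one_mul, zpow_one, inv_one, mul_one]
    refine lift_surfaceRelator_eq_self_of_forall _ fun i => ?_
    by_cases hi : i = k
    · subst hi; simp only [if_true, cond_true, cond_false]; group
    · simp [hi, genA, genB]
  · rintro ⟨i, _ | _⟩
    · by_cases hi : i = k
      · subst hi; simp [genA, genB, map_mul, map_inv]; group
      · simp [hi]
    · by_cases hi : i = k
      · subst hi; simp [genA, genB, map_mul, map_inv]; group
      · simp [hi]
  · rintro ⟨i, _ | _⟩
    · by_cases hi : i = k
      · subst hi; simp [genA, genB, map_mul, map_inv]; group
      · simp [hi]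
    · by_cases hi : i = k
      · subst hi; simp [genA, genB, map_mul, map_inv]; group
      · simp [hi]
  · rintro ⟨i, _ | _⟩
    · by_cases hi : i = k
      · subst hi; rw [← a_def, flipEquiv_a_self]; simp [map_mul, map_inv]
      · rw [← a_def, flipEquiv_a_of_ne hi]; simp [hi, mk_freeGroup_of, a_def]
    · by_cases hi : i = k
      · subst hi; rw [← b_def, flipEquiv_b_self]; simp [map_mul, map_inv]
      · rw [← b_def, flipEquiv_b_of_ne hi]; simp [hi, mk_freeGroup_of, b_def]

/-! ## The cut swaps lift -/

/-- **The cut swap `cutSwapEquiv c` is liftable** (`ε = 1`, `c = 1`): on the handles with `c i`,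
`a_i ↦ a_i b_i a_i⁻¹`, `b_i ↦ a_i⁻¹` (inverse `a_i ↦ b_i⁻¹`, `b_i ↦ b_i a_i b_i⁻¹`) define an
automorphism of the free group fixing every `[aᵢ, bᵢ]`, hence `r_g`, on the nose
(`[aba⁻¹, a⁻¹] = [a, b]` in the free group) — the quarter-twist of the chosen handles.
[cite: ZieschangVogtColdewey1980, §5.1 and Thm. 5.6.1] -/
theorem liftable_cutSwapEquiv (c : Fin g → Bool) :
    ∃ (φ : FreeGroup (surfaceGen g) ≃* FreeGroup (surfaceGen g)) (d : FreeGroup (surfaceGen g))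
      (ε : ℤ), (ε = 1 ∨ ε = -1) ∧ φ (surfaceRelator g) = d * surfaceRelator g ^ ε * d⁻¹ ∧
      ∀ x, PresentedGroup.mk _ (φ x) = cutSwapEquiv c (PresentedGroup.mk _ x) := by
  refine liftable_of_gens (cutSwapEquiv c)
    (fun p => if c p.1 then (bif p.2 then (genA p.1)⁻¹ else genA p.1 * genB p.1 * (genA p.1)⁻¹)
      else FreeGroup.of p)
    (fun p => if c p.1 then (bif p.2 then genB p.1 * genA p.1 * (genB p.1)⁻¹ else (genB p.1)⁻¹)
      else FreeGroup.of p)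
    1 1 (Or.inl rfl) ?_ ?_ ?_ ?_
  · rw [one_mul, zpow_one, inv_one, mul_one]
    refine lift_surfaceRelator_eq_self_of_forall _ fun i => ?_
    by_cases hi : c i
    · simp only [hi, if_true, cond_true, cond_false]; group
    · simp [hi, genA, genB]
  · rintro ⟨i, _ | _⟩
    · by_cases hi : c i
      · simp [hi, genA, genB, map_mul, map_inv]; group
      · simp [hi]
    · by_cases hi : c i
      · simp [hi, genA, genB, map_inv]
      · simp [hi]
  · rintro ⟨i, _ | _⟩
    · by_cases hi : c i
      · simp [hi, genA, genB, map_inv]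
      · simp [hi]
    · by_cases hi : c i
      · simp [hi, genA, genB, map_mul, map_inv]; group
      · simp [hi]
  · rintro ⟨i, _ | _⟩
    · rw [← a_def, cutSwapEquiv_a]
      by_cases hi : c i
      · simp [hi, map_mul, map_inv]
      · simp [hi, mk_freeGroup_of, a_def]
    · rw [← b_def, cutSwapEquiv_b]
      by_cases hi : c i
      · simp [hi, map_inv]
      · simp [hi, mk_freeGroup_of, b_def]

/-! ## The handle transvections lift -/

/-- **The handle transvection `transvEquiv k e : b_k ↦ b_k a_k^e` is liftable** (`ε = 1`,
`c = 1`): `a (b aᵉ) a⁻¹ (b aᵉ)⁻¹ = a b a⁻¹ b⁻¹` already in the free group — the Dehn twist about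
the meridian `a_k`, which misses the disc. [cite: ZieschangVogtColdewey1980, §5.1 and Thm. 5.6.1] -/
theorem liftable_transvEquiv (k : Fin g) (e : ℤ) :
    ∃ (φ : FreeGroup (surfaceGen g) ≃* FreeGroup (surfaceGen g)) (c : FreeGroup (surfaceGen g))
      (ε : ℤ), (ε = 1 ∨ ε = -1) ∧ φ (surfaceRelator g) = c * surfaceRelator g ^ ε * c⁻¹ ∧
      ∀ x, PresentedGroup.mk _ (φ x) = transvEquiv k e (PresentedGroup.mk _ x) := by
  refine liftable_of_gens (transvEquiv k e)
    (fun p => if p.1 = k then (bif p.2 then genB k * genA k ^ e else genA k) else FreeGroup.of p)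
    (fun p => if p.1 = k then (bif p.2 then genB k * genA k ^ (-e) else genA k) else FreeGroup.of p)
    1 1 (Or.inl rfl) ?_ ?_ ?_ ?_
  · rw [one_mul, zpow_one, inv_one, mul_one]
    refine lift_surfaceRelator_eq_self_of_forall _ fun i => ?_
    by_cases hi : i = k
    · subst hi; simp only [if_true, cond_true, cond_false]; group
    · simp [hi, genA, genB]
  · rintro ⟨i, _ | _⟩
    · by_cases hi : i = k
      · subst hi; simp [genA]
      · simp [hi]
    · by_cases hi : i = k
      · subst hi; simp [genA, genB, map_mul, map_zpow]
      · simp [hi]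
  · rintro ⟨i, _ | _⟩
    · by_cases hi : i = k
      · subst hi; simp [genA]
      · simp [hi]
    · by_cases hi : i = k
      · subst hi; simp [genA, genB, map_mul, map_zpow]
      · simp [hi]
  · rintro ⟨i, _ | _⟩
    · rw [← a_def, transvEquiv_a]
      by_cases hi : i = k
      · subst hi; simp
      · simp [hi, mk_freeGroup_of, a_def]
    · by_cases hi : i = k
      · subst hi; rw [← b_def, transvEquiv_b_self]; simp [map_mul, map_zpow]
      · rw [← b_def, transvEquiv_b_of_ne _ _ hi]; simp [hi, mk_freeGroup_of, b_def]

/-- **The dual handle transvection `transvAEquiv k e : a_k ↦ a_k b_k^e` is liftable** (`ε = 1`,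
`c = 1`): `(a bᵉ) b (a bᵉ)⁻¹ b⁻¹ = a b a⁻¹ b⁻¹` already in the free group — the Dehn twist about
`b_k`. [cite: ZieschangVogtColdewey1980, §5.1 and Thm. 5.6.1] -/
theorem liftable_transvAEquiv (k : Fin g) (e : ℤ) :
    ∃ (φ : FreeGroup (surfaceGen g) ≃* FreeGroup (surfaceGen g)) (c : FreeGroup (surfaceGen g))
      (ε : ℤ), (ε = 1 ∨ ε = -1) ∧ φ (surfaceRelator g) = c * surfaceRelator g ^ ε * c⁻¹ ∧
      ∀ x, PresentedGroup.mk _ (φ x) = transvAEquiv k e (PresentedGroup.mk _ x) := by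
  refine liftable_of_gens (transvAEquiv k e)
    (fun p => if p.1 = k then (bif p.2 then genB k else genA k * genB k ^ e) else FreeGroup.of p)
    (fun p => if p.1 = k then (bif p.2 then genB k else genA k * genB k ^ (-e)) else FreeGroup.of p)
    1 1 (Or.inl rfl) ?_ ?_ ?_ ?_
  · rw [one_mul, zpow_one, inv_one, mul_one]
    refine lift_surfaceRelator_eq_self_of_forall _ fun i => ?_
    by_cases hi : i = k
    · subst hi; simp only [if_true, cond_true, cond_false]; group
    · simp [hi, genA, genB]
  · rintro ⟨i, _ | _⟩
    · by_cases hi : i = k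
      · subst hi; simp [genA, genB, map_mul, map_zpow]
      · simp [hi]
    · by_cases hi : i = k
      · subst hi; simp [genB]
      · simp [hi]
  · rintro ⟨i, _ | _⟩
    · by_cases hi : i = k
      · subst hi; simp [genA, genB, map_mul, map_zpow]
      · simp [hi]
    · by_cases hi : i = k
      · subst hi; simp [genB]
      · simp [hi]
  · rintro ⟨i, _ | _⟩
    · by_cases hi : i = k
      · subst hi; rw [← a_def, transvAEquiv_a_self]; simp [map_mul, map_zpow]
      · rw [← a_def, transvAEquiv_a_of_ne _ _ hi]; simp [hi, mk_freeGroup_of, a_def]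
    · rw [← b_def, transvAEquiv_b]
      by_cases hi : i = k
      · subst hi; simp
      · simp [hi, mk_freeGroup_of, b_def]

end SurfaceGroup

end Literature.Topology.FourManifolds

end
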